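import Mathlib
import HarnessLib
import Summits.AnomalousDissipation.AnomalousDissipation.Theses.ImpulseGrid
import Literature.Analysis.FluidPDE.TorusClassicalLerayHopfProofs
import Literature.Analysis.FluidPDE.LongTimeAveragePeriodic
import Summits.AnomalousDissipation.AnomalousDissipation.Theorems.BaireTransferDenseLoudDesignerForcesStubGalileanCovariance
import Summits.AnomalousDissipation.AnomalousDissipation.Theorems.BaireTransferDenseLoudDesignerForcesStubBoostBudgets
import Summits.AnomalousDissipation.AnomalousDissipation.Theorems.ImpulseGridBoundedEnergyGridStubGridOfColumnar

/-!
# `ImpulseGrid.BoundedEnergyGrid` from time-periodic ZERO-MOMENTUM classical states on `T³` under a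
# columnar transverse force (line `Sketch`, crux stmt-AnomalousDissipation-10430): the Galilean door

Support file for the crux `Summit.AnomalousDissipation.AnomalousDissipation.Theses.ImpulseGrid.BoundedEnergyGrid`
(item stmt-AnomalousDissipation-10430). The line `Sketch` closes the crux from PLANAR steady states
(`ImpulseGridBoundedEnergyGridOfPlanar`); this file records the weakest CLASSICAL door the same mechanism
opens, with no columnar structure required of the witnesses:

  `boundedEnergyGrid_of_columnarPeriodicZeroMomentum` — if ONE smooth transverse columnar force `G` on `T³`
  (`x₀`-invariant, `G·e₀ = 0`, divergence free, mean zero, `G ≠ 0`) admits, along some `ν_j → 0⁺`, classical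
  solutions `W_j` of `NS_{ν_j}(G)` on `ℝ × T³` that are time-periodic (any periods `τ_j > 0`), have ZERO
  MOMENTUM at every time, and have mean energies `⟨‖W_j‖²⟩ ≤ E`, then `BoundedEnergyGrid` holds.

Mechanism: the design `Φ ≡ 1`, `c = 1` and the Galilean BOOST `u_j(t, x) = e₀ + W_j(t, x − [t e₀])` along
the columns (`DenseLoudDesignerForces.Galilean.boost`, landed): the swept force `G(· + [t e₀])` IS `G`
(`x₀`-invariance), so by the landed Galilean covariance of classical Navier–Stokes solutions
(`Galilean.Covariance.stub_galileanCovariance`) `u_j` is a classical solution of `NS_{ν_j}(G)` on `ℝ × T³`,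
hence a global Leray–Hopf solution from its time-zero slice `e₀ + W_j(0)` (momentum `e₀`); slice-wise
`∫‖u_j(t)‖² = 1 + ∫‖W_j(t)‖²` (`Galilean.BoostBudgets.integral_norm_sq_boost`, zero momentum kills the
cross term), a `τ_j`-periodic function of time, so `meanEnergy u_j = 1 + meanEnergy W_j ≤ 1 + E`
(`longTimeAvgSup_eq_of_periodic`). Steady states are the case `τ_j = 1`. No definitions, no named facts.
-/

-- `Summit.<Summit>.<Problem>` is the tree's mandated summit-side namespace (CONVENTIONS §2); for this
-- single-conjunct summit the two coincide, so the duplicate is deliberate.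
set_option linter.dupNamespace false

noncomputable section

open MeasureTheory Filter Topology Set
open Literature.Analysis.FunctionSpaces Literature.Analysis.FunctionSpaces.Torus
open Literature.Analysis.FluidPDE Literature.Analysis.FluidPDE.Torus
open Summit.AnomalousDissipation.AnomalousDissipation.Theorems.DenseLoudDesignerForces.Galilean

namespace Summit.AnomalousDissipation.AnomalousDissipation.Theorems

/-- Along the columns the swept force is the force: for an `x₀`-invariant `G`,
`sweptForce e₀ G t y = G (y + [t e₀]) = G y`. [folklore] -/
theorem sweptForce_single_zero_eq_of_invariant {G : UnitAddTorus (Fin 3) → EuclideanSpace ℝ (Fin 3)}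
    (hGinv : ∀ (s : UnitAddCircle) x, G (x + Pi.single (0 : Fin 3) s) = G x) :
    sweptForce (EuclideanSpace.single (0 : Fin 3) (1 : ℝ)) G = fun _ => G := by
  funext t y
  simp only [sweptForce]
  rw [columnLift_proj_smul_single, hGinv]

/-- **Mean energy of a Galilean boost of a time-periodic zero-momentum classical field along `e₀`**:
`meanEnergy (e₀ + W(t, · − [t e₀])) = 1 + meanEnergy W` for a jointly smooth `τ`-periodic `W` with
`∫ W(t) = 0` for all `t` (slice-wise `∫‖e₀ + W(t, · − [t e₀])‖² = 1 + ∫‖W(t)‖²`, a `τ`-periodic function of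
time; long-time averages of periodic functions are period means). [folklore] -/
theorem meanEnergy_boost_single_zero_of_periodic {W : ℝ → UnitAddTorus (Fin 3) → EuclideanSpace ℝ (Fin 3)}
    {τ : ℝ} (hW : IsSmoothSpaceTimeOn univ W) (hper : Function.Periodic W τ) (hτ : 0 < τ)
    (hmean : ∀ t, HasZeroMean (W t)) :
    meanEnergy (boost (EuclideanSpace.single (0 : Fin 3) (1 : ℝ)) W) = 1 + meanEnergy W := by
  have hslice : ∀ t, ∫ x, ‖boost (EuclideanSpace.single (0 : Fin 3) (1 : ℝ)) W t x‖ ^ 2 =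
      1 + ∫ x, ‖W t x‖ ^ 2 := fun t => by
    rw [BoostBudgets.integral_norm_sq_boost hW hmean t]
    simp
  have hpe : Function.Periodic (fun t => ∫ x, ‖W t x‖ ^ 2) τ := fun t => by
    simp only [hper t]
  have hpb : Function.Periodic
      (fun t => ∫ x, ‖boost (EuclideanSpace.single (0 : Fin 3) (1 : ℝ)) W t x‖ ^ 2) τ := fun t => by
    simp only [hslice, hper t]
  have he_st : IsSmoothSpaceTimeOn univ (fun r x => ‖W r x‖ ^ 2) := by
    change ContDiffOn ℝ _ (fun z => ‖Torus.stLift W z‖ ^ 2) _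
    exact hW.norm_sq ℝ
  have he_cont : Continuous fun r => ∫ x, ‖W r x‖ ^ 2 :=
    continuousOn_univ.1 (he_st.continuousOn_integral convex_univ)
  have he_int : IntervalIntegrable (fun r => ∫ x, ‖W r x‖ ^ 2) volume 0 τ :=
    he_cont.intervalIntegrable _ _
  rw [meanEnergy_eq_longTimeAvgSup, meanEnergy_eq_longTimeAvgSup, longTimeAvgSup_eq_of_periodic hpb hτ,
    longTimeAvgSup_eq_of_periodic hpe hτ]
  simp_rw [hslice]
  rw [intervalIntegral.integral_add intervalIntegrable_const he_int, intervalIntegral.integral_const,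
    sub_zero, smul_eq_mul, mul_one, mul_add, inv_mul_cancel₀ hτ.ne']

/-- **Time-periodic zero-momentum classical states under a columnar transverse force ⇒
`BoundedEnergyGrid`** (the Galilean door of line `Sketch`, crux stmt-AnomalousDissipation-10430). If one
smooth `x₀`-invariant transverse (`G·e₀ = 0`) divergence-free mean-zero force `G ≠ 0` on `T³` admits, along
some `ν_j → 0⁺`, jointly smooth classical solutions `W_j` of `NS_{ν_j}(G)` on `ℝ × T³`, time-periodic with
periods `τ_j > 0`, with zero momentum `∫ W_j(t) = 0` at all times and mean energies `⟨‖W_j‖²⟩ ≤ E`, then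
`ImpulseGrid.BoundedEnergyGrid` holds, with the design `Φ ≡ 1`, `c = 1` and the boosted witnesses
`u_j(t, x) = e₀ + W_j(t, x − [t e₀])` from the data `e₀ + W_j(0)`. [folklore] -/
theorem boundedEnergyGrid_of_columnarPeriodicZeroMomentum
    (h : ∃ G : UnitAddTorus (Fin 3) → EuclideanSpace ℝ (Fin 3),
      IsSmooth G ∧ (∀ (s : UnitAddCircle) x, G (x + Pi.single (0 : Fin 3) s) = G x) ∧ (∀ x, G x 0 = 0) ∧
      IsDivFree G ∧ HasZeroMean G ∧ G ≠ 0 ∧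
      ∃ (ν : ℕ → ℝ) (W : ℕ → ℝ → UnitAddTorus (Fin 3) → EuclideanSpace ℝ (Fin 3))
        (q : ℕ → ℝ → UnitAddTorus (Fin 3) → ℝ) (τ : ℕ → ℝ),
        (∀ j, 0 < ν j) ∧ Tendsto ν atTop (𝓝 0) ∧
        (∀ j, IsClassicalNSSolutionOn univ (ν j) (fun _ => G) (W j) (q j)) ∧
        (∀ j, 0 < τ j) ∧ (∀ j, Function.Periodic (W j) (τ j)) ∧
        (∀ j t, HasZeroMean (W j t)) ∧
        ∃ E : ℝ, ∀ j, meanEnergy (W j) ≤ E) :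
    Summit.AnomalousDissipation.AnomalousDissipation.Theses.ImpulseGrid.BoundedEnergyGrid := by
  obtain ⟨G, hG, hGinv, hG0, hGd, hGm, hGne, ν, W, q, τ, hν, hν0, hW, hτ, hper, hmean, E, hE⟩ := h
  -- the design `Φ ≡ 1`, `c = 1`
  have h1 : (fun x => (1 : ℝ) • G x) = G := funext fun x => one_smul ℝ (G x)
  have hs : IsSmooth (fun x => (1 : ℝ) • G x) := by rw [h1]; exact hG
  have hd : IsDivFree (fun x => (1 : ℝ) • G x) := by rw [h1]; exact hGd
  have hm : HasZeroMean (fun x => (1 : ℝ) • G x) := by rw [h1]; exact hGm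
  have hne : (fun x => (1 : ℝ) • G x) ≠ 0 := by rw [h1]; exact hGne
  have hmass : ∫ _ : UnitAddTorus (Fin 3), (1 : ℝ) = 1 := by simp
  -- the boosted witnesses are classical, hence global Leray–Hopf
  have hswept : sweptForce (EuclideanSpace.single (0 : Fin 3) (1 : ℝ)) G = fun _ => G :=
    sweptForce_single_zero_eq_of_invariant hGinv
  have hcl : ∀ j, IsClassicalNSSolutionOn univ (ν j) (fun _ => fun x => (1 : ℝ) • G x)
      (boost (EuclideanSpace.single (0 : Fin 3) (1 : ℝ)) (W j))
      (boostScalar (EuclideanSpace.single (0 : Fin 3) (1 : ℝ)) (q j)) := fun j => by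
    rw [h1]
    refine Covariance.stub_galileanCovariance (ν j) _ G (W j) (q j) ?_
    rw [hswept]
    exact hW j
  have hLH : ∀ j, IsGlobalLerayHopf (ν j) (fun _ => fun x => (1 : ℝ) • G x)
      (boost (EuclideanSpace.single (0 : Fin 3) (1 : ℝ)) (W j) 0)
      (boost (EuclideanSpace.single (0 : Fin 3) (1 : ℝ)) (W j)) := fun j => (hcl j).isGlobalLerayHopf
  -- momentum of the data: `∫ (e₀ + W_j(0)) = e₀`
  have hmom : ∀ j, ∫ x, boost (EuclideanSpace.single (0 : Fin 3) (1 : ℝ)) (W j) 0 x =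
      (1 : ℝ) • EuclideanSpace.single (0 : Fin 3) (1 : ℝ) := fun j => by
    have hW0 : IsSmooth (W j 0) := (hW j).smooth_velocity.isSmooth_slice (mem_univ 0)
    have hb : boost (EuclideanSpace.single (0 : Fin 3) (1 : ℝ)) (W j) 0 =
        fun x => EuclideanSpace.single (0 : Fin 3) (1 : ℝ) + W j 0 x := by
      funext x
      simp [boost, Torus.proj_zero]
    rw [hb]
    exact columnLift_integral_single_add hW0 (hmean j 0)
  -- mean energy of the boosts
  have hen : ∀ j, meanEnergy (boost (EuclideanSpace.single (0 : Fin 3) (1 : ℝ)) (W j)) ≤ 1 + E :=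
    fun j => by
      rw [meanEnergy_boost_single_zero_of_periodic (hW j).smooth_velocity (hper j) (hτ j) (hmean j)]
      exact add_le_add le_rfl (hE j)
  exact ⟨fun _ => 1, G, 1, isSmooth_const _, hG, fun _ _ => ⟨rfl, rfl⟩, hmass, hGinv, hG0, hs, hd, hm,
    hne, one_pos, ν, fun j => boost (EuclideanSpace.single (0 : Fin 3) (1 : ℝ)) (W j) 0,
    fun j => boost (EuclideanSpace.single (0 : Fin 3) (1 : ℝ)) (W j), hν, hν0, hLH, hmom, 1 + E, hen⟩

/-- **Steady zero-momentum states on `T³` under a columnar transverse force ⇒ `BoundedEnergyGrid`**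
(the steady case of `boundedEnergyGrid_of_columnarPeriodicZeroMomentum`, period `1`): one smooth
`x₀`-invariant transverse divergence-free mean-zero `G ≠ 0` with, along some `ν_j → 0⁺`, smooth ZERO-MOMENTUM
steady states `W_j` of `NS_{ν_j}(G)` on `T³` — no symmetry asked of `W_j` — and `∫‖W_j‖² ≤ E` gives the crux.
This is strictly weaker a hypothesis than the planar / columnar steady branches of the line. [folklore] -/
theorem boundedEnergyGrid_of_columnarSteadyZeroMomentum
    (h : ∃ G : UnitAddTorus (Fin 3) → EuclideanSpace ℝ (Fin 3),
      IsSmooth G ∧ (∀ (s : UnitAddCircle) x, G (x + Pi.single (0 : Fin 3) s) = G x) ∧ (∀ x, G x 0 = 0) ∧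
      IsDivFree G ∧ HasZeroMean G ∧ G ≠ 0 ∧
      ∃ (ν : ℕ → ℝ) (W : ℕ → UnitAddTorus (Fin 3) → EuclideanSpace ℝ (Fin 3))
        (q : ℕ → UnitAddTorus (Fin 3) → ℝ),
        (∀ j, 0 < ν j) ∧ Tendsto ν atTop (𝓝 0) ∧
        (∀ j, IsSteadyNSState (ν j) G (W j) (q j)) ∧
        (∀ j, HasZeroMean (W j)) ∧
        ∃ E : ℝ, ∀ j, ∫ x, ‖W j x‖ ^ 2 ≤ E) :
    Summit.AnomalousDissipation.AnomalousDissipation.Theses.ImpulseGrid.BoundedEnergyGrid := by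
  obtain ⟨G, hG, hGinv, hG0, hGd, hGm, hGne, ν, W, q, hν, hν0, hst, hmean, E, hE⟩ := h
  refine boundedEnergyGrid_of_columnarPeriodicZeroMomentum ⟨G, hG, hGinv, hG0, hGd, hGm, hGne, ν,
    fun j _ => W j, fun j _ => q j, fun _ => 1, hν, hν0, fun j => hst j, fun _ => one_pos,
    fun j _ => rfl, fun j _ => hmean j, E, fun j => ?_⟩
  rw [meanEnergy_eq_of_periodic (τ := 1) (fun _ => rfl) one_pos]
  simpa using hE j

end Summit.AnomalousDissipation.AnomalousDissipation.Theorems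

end
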